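import Mathlib
import Literature.AlgebraicGeometry.Resolution.SyzygySheaf
import Summits.ResolutionOfSingularities.ResolutionOfSingularities.Theorems.SyzygyFlatteningDefs
import HarnessLib

/-!
# `stub_extendResolution` — prepending two prescribed steps to a free resolution of finite type

Crux `SyzygyFlattening.RankOneTermination` (stmt-ResolutionOfSingularities-17044), line `birth`,
registered stub `stub_extendResolution` — PROVED (statement verbatim from the ledger
registration): over a Noetherian ring `R`, a surjection `ε₀ : R^{b₀} ↠ N` and a map
`φ : R^{b₁} → R^{b₀}` with `R^{b₁} —φ→ R^{b₀} —ε₀→ N` exact extend to a free resolution of finite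
type `(b, d, ε)` of `N` (`ε = ε₀`, `d 0 = φ`) whose second syzygy module `range (d 1)` is
linearly isomorphic (indeed equal) to `ker φ`.

Proof (Bruns–Herzog §1.3, construction of a resolution by successive finite covers of kernels).
`ker φ ⊆ R^{b₁}` is a finite `R`-module (`R` Noetherian), so the tree's
`Literature.AlgebraicGeometry.Resolution.FreeResolution.ofNoetherian` gives a free resolution of
finite type `G` of `ker φ`: `⋯ → R^{c₁} —G.d 0→ R^{c₀} —G.ε↠ ker φ`.  Splice:
`b = (b₀, b₁, c₀, c₁, …)`, `d 0 = φ`, `d 1 = (ker φ ↪ R^{b₁}) ∘ G.ε`, `d (i + 2) = G.d i`,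
`ε = ε₀`.  Exactness at `R^{b₀}` is the hypothesis; at `R^{b₁}`,
`Exact ((ker φ).subtype ∘ G.ε) φ ⟸ Exact (ker φ).subtype φ` (`G.ε` onto, Mathlib
`Function.Surjective.comp_exact_iff_exact`, `LinearMap.exact_subtype_ker_map`); at `R^{c₀}`,
`Exact (G.d 0) ((ker φ).subtype ∘ G.ε) ⟸ Exact (G.d 0) G.ε` (the subtype is injective,
`Function.Injective.comp_exact_iff_exact`); further up it is `G.exact_succ`.  Finally
`range (d 1) = range ((ker φ).subtype ∘ G.ε) = range (ker φ).subtype = ker φ`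
(`LinearMap.range_comp_of_range_eq_top`, `Submodule.range_subtype`), and `LinearEquiv.ofEq`
turns the equality of submodules of `R^{b₁}` into the required linear equivalence.
-/

noncomputable section

-- single-problem summit: the doubled namespace component `ResolutionOfSingularities` is forced
set_option linter.dupNamespace false

namespace Summit.ResolutionOfSingularities.ResolutionOfSingularities.Theorems.SyzygyFlattening

open Literature.AlgebraicGeometry.Resolution (FreeResolution)

/-- **STUB `stub_extendResolution`** — a surjection `ε₀ : R^{b₀} → N` and a map `φ : R^{b₁} → R^{b₀}`
exact at `R^{b₀}` extend, over a Noetherian ring, to a free resolution of finite type of `N` whose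
second syzygy module `range (d 1)` is (isomorphic to) `ker φ`: prepend the two given steps to a
free resolution of finite type of the finite module `ker φ` (tree `FreeResolution.ofNoetherian`;
Bruns–Herzog §1.3, the successive kernels `Mᵢ = Ker φᵢ₋₁` of an augmented resolution by finite
free modules). [cite: BrunsHerzog1998, §1.3 (before Prop. 1.3.1)] -/
theorem stub_extendResolution : ∀ (R : Type) [CommRing R] [IsNoetherianRing R]
    (N : Type) [AddCommGroup N] [Module R N] (b₀ b₁ : ℕ)
    (ε₀ : (Fin b₀ → R) →ₗ[R] N) (φ : (Fin b₁ → R) →ₗ[R] (Fin b₀ → R)),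
      Function.Surjective ε₀ → Function.Exact φ ε₀ →
      ∃ (b : ℕ → ℕ) (d : (i : ℕ) → ((Fin (b (i + 1)) → R) →ₗ[R] (Fin (b i) → R)))
        (ε : (Fin (b 0) → R) →ₗ[R] N),
        Function.Surjective ε ∧ Function.Exact (d 0) ε ∧ (∀ i : ℕ, Function.Exact (d (i + 1)) (d i)) ∧
        Nonempty (↥(LinearMap.ker φ) ≃ₗ[R] ↥(LinearMap.range (d 1))) := by
  intro R _ _ N _ _ b₀ b₁ ε₀ φ hε hφ
  -- a free resolution of finite type of the finite (R Noetherian) module `ker φ ⊆ R^{b₁}`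
  let G : FreeResolution R ↥(LinearMap.ker φ) := FreeResolution.ofNoetherian (LinearMap.ker φ)
  -- the spliced differential `R^{c₀} ↠ ker φ ↪ R^{b₁}` has image `ker φ`
  have hr : LinearMap.range ((LinearMap.ker φ).subtype ∘ₗ G.ε) = LinearMap.ker φ := by
    rw [LinearMap.range_comp_of_range_eq_top _ (LinearMap.range_eq_top.2 G.ε_surjective),
      Submodule.range_subtype]
  -- the spliced resolution `⋯ → R^{c₁} → R^{c₀} → R^{b₁} —φ→ R^{b₀} —ε₀→ N → 0`
  let F : FreeResolution R N :=
    { rank := fun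
        | 0 => b₀
        | 1 => b₁
        | i + 2 => G.rank i
      d := fun
        | 0 => φ
        | 1 => (LinearMap.ker φ).subtype ∘ₗ G.ε
        | i + 2 => G.d i
      ε := ε₀
      ε_surjective := hε
      exact_zero := hφ
      exact_succ := fun
        | 0 => G.ε_surjective.comp_exact_iff_exact.2 (LinearMap.exact_subtype_ker_map φ)
        | 1 => (LinearMap.ker φ).injective_subtype.comp_exact_iff_exact.2 G.exact_zero
        | i + 2 => G.exact_succ i }
  exact ⟨F.rank, F.d, F.ε, F.ε_surjective, F.exact_zero, F.exact_succ,
    ⟨LinearEquiv.ofEq _ _ hr.symm⟩⟩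

end Summit.ResolutionOfSingularities.ResolutionOfSingularities.Theorems.SyzygyFlattening

end
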